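import Literature.RepresentationTheory.HeisenbergGroup.SchrodingerFibreIrreducibility      -- ★ fibres `f ↦ f(θ, ·)` (`exists_fibreMap`, `sumElim_mem_schwartzBruhat`), dot-model irreducibility
import Literature.NumberTheory.Automorphic.LocalSchwartzBruhatDirectSum                     -- ★ `mul_resL_resR_mem_schwartzBruhat` (products in separate variables are Schwartz–Bruhat)
import Literature.RepresentationTheory.TwistedCoinvariants                                   -- ★ `TwistedCoinv.ker ∕ Coinv ∕ mk ∕ lift ∕ rep`
import Summits.HodgeConjecture.HodgeConjecture.Theorems.F0P2oLocallyConstantCoboundary      -- ★ p829212 F0P2-p05 (g0): the locally-constant coboundary lemma (road (S3))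
import HarnessLib

/-!
# Crux `H413`, programme P2, N3 road (S1) — THE `Y`-COINVARIANTS OF THE SCHRÖDINGER MODEL ALONG A TOTALLY ISOTROPIC `Y`:
# in the `Y`-adapted model `𝒮(F^{ι₁ ⊔ ι₀})` they ARE the fibre over `0`, `f ↦ f(0, ·) ∈ 𝒮(F^{ι₀})`, equivariantly for `H(Y^⊥) ↠ H(Y^⊥ ∕ Y)`

Cell hodgecm-mathlib (D-0151), FLOOR 0, crux item H413 = stmt-HodgeConjecture-24833, programme P2; the #76 U′-N pay-down's last print residue
N3 (★ letter `GelbartRogawski1991.thetaType_nonsplit_jacquetModule`, INVENTORY III-42), road note `F0/P2/B-p18/g28/N3-ROAD.v1.B-p18g28.md`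
(K1 lead B-p18 (g28)) §2 step **(S1)** «the `Y`-coinvariants `S_Y := S ∕ ⟨ρ(y)φ − φ : y ∈ Y⟩` of a model `S` of the Heisenberg representation of
`H(𝕎)` carry the Heisenberg representation of `H(Y^⊥ ∕ Y) = H(𝕎₁)` (irreducible, central character `ψ`) — computed in ONE convenient model»;
F0P2-plan (g8) ROW «N3-S1 Y-COINVARIANTS OF THE SCHRÖDINGER MODEL» 2026-08-31T17:52:54Z, seat A-p12 (g17).  THEOREMS ONLY (no `def`, no instance,
no notation, no named fact, no `sorry`); never imports a `Cruxes/…/Lines` module; kernel lane `--supports stmt-HodgeConjecture-24833 --as helper`.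
HC_CM is proved only modulo the 2 remaining named inputs (hLiu418, h413) until rung 0 closes; nothing printed is asserted here.

THE CONVENIENT MODEL.  `F` a non-archimedean local field, `ψ` a locally constant (for the kernel: continuous non-trivial) additive character,
finite index types `ι₁`, `ι₀`, and the tree's smooth «dot» Schrödinger model `ρ = schrodingerSB ⟨·,·⟩ ψ` of `H(𝕎)`, `𝕎 = X × X^*`, `X = F^{ι₁ ⊔ ι₀}`
(★ `SchrodingerModel`, `SchrodingerCommutantPi`: `(ρ((x,y),t) f)(u) = ψ(t + ⟨u, y⟩) f(u + x)`).  The totally isotropic subspace is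
**`Y = 0 × (F^{ι₁} × 0)`** — the MODULATIONS `ρ(0, (y₁, 0), 0)`, `(ρ f)(u) = ψ(⟨u|ι₁, y₁⟩) f(u)`, in the `ι₁`-variables only; then
`Y^⊥ = {((x, y), t) : x|ι₁ = 0}`, `𝕎₁ := Y^⊥ ∕ Y = F^{ι₀} × F^{ι₀}` with the dot pairing, and `H(Y^⊥) ↠ H(𝕎₁)` is `((x,y),t) ↦ ((x|ι₀, y|ι₀), t)`.
This is the polarisation ADAPTED to `Y` (the «Heisenberg-parabolic ∕ Kirillov» chart of ★ `SchrodingerFibreIrreducibility`); the tree's own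
`omegaLoc v` lives in the (re, im) chart `𝒮(F_v³)` of `E_w³`, in which `Y = ℓ ⊗ W` (`ℓ = T e₁` an isotropic `E_w`-line of the DIAGONAL form) is in
general position — the passage is ★ `SchrodingerSymplecticTransport.exists_intertwiner_of_symplectic` along an adapted symplectic chart `Γ` with
`Γ Y = 0 × (F^{ι₁} × 0)` (road steps (S2)∕(S5), not this file) [MoeglinVignerasWaldspurger1987, Chap. 2 II.1–II.2].

THE FIBRE OVER `0`.  Every statement is about an arbitrary linear map `φ₀ : 𝒮(F^{ι₁ ⊔ ι₀}) →ₗ 𝒮(F^{ι₀})` with `(φ₀ f)(u₀) = f(0, u₀)` (one exists: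
★ `exists_fibreMap 0`; no new constant is introduced).
* §1 `fibreZero_surjective` (extend `g` by `1_{𝒪^{ι₁}} ⊗ g`, ★ `mul_resL_resR_mem_schwartzBruhat`).
* §2 THE KERNEL: `Y` dies on the fibre (`fibreZero_schrodingerSB_piModul`), and conversely **`mem_span_of_fibreZero_eq_zero`** — a function vanishing
  on the fibre over `0` is a finite sum of `Y`-coboundaries `ρ(y) φ − φ` (★ p829212 `mem_span_mul_sub_of_forall_eq_zero` at `X₀ = {u|ι₁ = 0}`,
  `𝒰 = {ψ(⟨·|ι₁, y₁⟩)}`; separation = `ψ` non-trivial); hence **`ker_fibreZero_eq_span`**: `ker φ₀ = span {ρ(0,(y₁,0),0) φ − φ}`.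
* §3 EQUIVARIANCE **`fibreZero_schrodingerSB_of_comp_inl_eq_zero`**: for `h = ((x,y),t)` with `x|ι₁ = 0`,
  `φ₀ (ρ h f) = ρ₀((x|ι₀, y|ι₀), t) (φ₀ f)` — `φ₀` intertwines `ρ|_{H(Y^⊥)}` with the dot Schrödinger model `ρ₀` of `H(𝕎₁)` on `𝒮(F^{ι₀})`
  (so `Y` acts trivially and the centre by `ψ` on the quotient).
* §4 THE `Y`-COINVARIANTS: `exists_quotient_span_equiv_fibre` (`𝒮 ∕ span ≃ₗ 𝒮(F^{ι₀})` through `φ₀`); **`eq_span_or_eq_top_of_invariant`** — a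
  subspace containing the coboundaries and stable under `ρ(H(Y^⊥))` is the coboundaries or everything, i.e. `S_Y` IS IRREDUCIBLE under `H(𝕎₁)`
  (★ `eq_bot_or_eq_top_of_invariant_schrodingerSB_pi`); and the `TwistedCoinv` currency of (S2)∕(S4): for ANY homomorphism `j : Z →* H(𝕎)` onto
  `Ỹ = Y · centre` read with the character `χ = ψ ∘ t` (`hj`, `hχ`), **`twistedCoinv_ker_eq_ker_fibreZero`** (`TwistedCoinv.ker (ρ ∘ j) χ = ker φ₀`) and
  **`exists_twistedCoinv_equiv_fibre`** — `TwistedCoinv.Coinv (ρ ∘ j) χ ≃ₗ 𝒮(F^{ι₀})` over `φ₀`, intertwining `TwistedCoinv.rep` of any commuting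
  action that `φ₀` carries to `σ` with `σ`.
This is [MoeglinVignerasWaldspurger1987, Chap. 2 I.3–I.4; Chap. 3 §IV.2 (the mixed model), §IV.5 (filtration de Kudla)] ∕ [Kudla1986, proof of
Thm. 2.8] for the first step of Kudla's filtration, written model-explicitly; [BernsteinZelevinsky1976, §1–§2.33] for the coinvariant functor.

## References
* [MoeglinVignerasWaldspurger1987] C. Mœglin, M.-F. Vignéras, J.-L. Waldspurger, *Correspondances de Howe sur un corps p-adique*, LNM 1291 (1987):
  Chap. 2 I.3–I.4 (Schrödinger and mixed models), II.1–II.2; Chap. 3 §IV.2, §IV.5.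
* [Kudla1986] S. Kudla, *On the local theta-correspondence*, Invent. Math. 83 (1986) 229–255: proof of Thm. 2.8 (Jacquet modules of the Weil
  representation along a totally isotropic subspace).
* [BernsteinZelevinsky1976] I. N. Bernstein, A. V. Zelevinsky, Russian Math. Surveys 31 (1976): §1.1, §2.30–2.33 (coinvariants).
* [WeilBNT1967] A. Weil, *Basic Number Theory* (1967), Ch. VII §2 (standard functions on `F^ι`).
-/

set_option autoImplicit false
set_option linter.dupNamespace false -- the mandated namespace repeats the single-problem summit's segment

noncomputable section

open Set
open Literature.NumberTheory.Automorphic Literature.RepresentationTheory Literature.RepresentationTheory.HeisenbergGroup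
open Summit.HodgeConjecture.HodgeConjecture.Cruxes.H413.F0P2oLocallyConstantCoboundary

namespace Summit.HodgeConjecture.HodgeConjecture.Cruxes.H413.F0P2oHeisenbergYCoinvariants

variable {F : Type*} [Field F] [ValuativeRel F] [TopologicalSpace F] [IsNonarchimedeanLocalField F]
  {ι₁ ι₀ : Type*} [Fintype ι₁] [Fintype ι₀]
  {ψ : AddChar F Circle} (hl : IsLocallyConstant (⇑ψ : F → Circle))
  (hb : ∀ y : ι₁ ⊕ ι₀ → F, Continuous fun u : ι₁ ⊕ ι₀ → F => dotProductBilin F F u y)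
  (hb₀ : ∀ y₀ : ι₀ → F, Continuous fun u₀ : ι₀ → F => dotProductBilin F F u₀ y₀)

/-! ## §0 Coordinates on `F^{ι₁ ⊔ ι₀}` -/

omit [ValuativeRel F] [TopologicalSpace F] [IsNonarchimedeanLocalField F] [Fintype ι₁] [Fintype ι₀] in
/-- `(a, b) + (a', b') = (a + a', b + b')` in `F^{ι₁ ⊔ ι₀}`. [folklore] -/
theorem sumElim_add_sumElim (a a' : ι₁ → F) (b b' : ι₀ → F) :
    (Sum.elim a b : ι₁ ⊕ ι₀ → F) + Sum.elim a' b' = Sum.elim (a + a') (b + b') := by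
  funext i
  rcases i with i | i <;> rfl

omit [ValuativeRel F] [TopologicalSpace F] [IsNonarchimedeanLocalField F] in
/-- on the fibre over `0` the pairing only sees the `ι₀`-coordinates: `⟨(0, u₀), y⟩ = ⟨u₀, y|ι₀⟩`. [folklore] -/
theorem sumElim_zero_dotProduct (u₀ : ι₀ → F) (y : ι₁ ⊕ ι₀ → F) :
    (Sum.elim 0 u₀ : ι₁ ⊕ ι₀ → F) ⬝ᵥ y = u₀ ⬝ᵥ (y ∘ Sum.inr) := by
  conv_lhs => rw [← Sum.elim_comp_inl_inr y]
  rw [sumElim_dotProduct_sumElim, zero_dotProduct, zero_add]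

omit [ValuativeRel F] [TopologicalSpace F] [IsNonarchimedeanLocalField F] in
/-- the pairing against a vector of `Y = F^{ι₁} × 0` only sees the `ι₁`-coordinates: `⟨u, (y₁, 0)⟩ = ⟨u|ι₁, y₁⟩`. [folklore] -/
theorem dotProduct_sumElim_zero (u : ι₁ ⊕ ι₀ → F) (y₁ : ι₁ → F) :
    u ⬝ᵥ (Sum.elim y₁ 0 : ι₁ ⊕ ι₀ → F) = (u ∘ Sum.inl) ⬝ᵥ y₁ := by
  conv_lhs => rw [← Sum.elim_comp_inl_inr u]
  rw [sumElim_dotProduct_sumElim, dotProduct_zero, add_zero]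

omit [ValuativeRel F] [TopologicalSpace F] [IsNonarchimedeanLocalField F] [Fintype ι₁] [Fintype ι₀] in
/-- a point of `X₀ = {u : u|ι₁ = 0}` is `(0, u|ι₀)`. [folklore] -/
theorem eq_sumElim_zero_of_comp_inl_eq_zero {u : ι₁ ⊕ ι₀ → F} (hu : u ∘ Sum.inl = 0) : u = Sum.elim (0 : ι₁ → F) (u ∘ Sum.inr) := by
  rw [← hu, Sum.elim_comp_inl_inr]

variable (φ₀ : SchwartzBruhat (ι₁ ⊕ ι₀ → F) →ₗ[ℂ] SchwartzBruhat (ι₀ → F))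
  (hφ₀ : ∀ (f : SchwartzBruhat (ι₁ ⊕ ι₀ → F)) (u₀ : ι₀ → F),
    (φ₀ f : (ι₀ → F) → ℂ) u₀ = (f : (ι₁ ⊕ ι₀ → F) → ℂ) (Sum.elim 0 u₀))

include hφ₀

/-! ## §1 The fibre over `0` is onto `𝒮(F^{ι₀})` -/

omit [Fintype ι₀] in
/-- **the fibre-over-`0` map is SURJECTIVE**: `g ∈ 𝒮(F^{ι₀})` is the fibre over `0` of `u ↦ 1_{𝒪^{ι₁}}(u|ι₁) · g(u|ι₀) ∈ 𝒮(F^{ι₁ ⊔ ι₀})`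
(★ `mul_resL_resR_mem_schwartzBruhat` at the trivial enumeration). [cite: WeilBNT1967, Ch. VII §2, Prop. 2] -/
theorem fibreZero_surjective : Function.Surjective φ₀ := by
  intro g
  have hmem : (fun v : ι₁ ⊕ ι₀ → F =>
      ((piBallSB F ι₁ 0 : SchwartzBruhat (ι₁ → F)) : (ι₁ → F) → ℂ) (resL (Equiv.refl (ι₁ ⊕ ι₀)) v) *
        (g : (ι₀ → F) → ℂ) (resR (Equiv.refl (ι₁ ⊕ ι₀)) v)) ∈ SchwartzBruhat (ι₁ ⊕ ι₀ → F) :=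
    mul_resL_resR_mem_schwartzBruhat (Equiv.refl (ι₁ ⊕ ι₀)) (piBallSB F ι₁ 0).2 g.2
  refine ⟨⟨_, hmem⟩, Subtype.ext (funext fun u₀ => ?_)⟩
  rw [hφ₀]
  change ((piBallSB F ι₁ 0 : SchwartzBruhat (ι₁ → F)) : (ι₁ → F) → ℂ) (fun i => (Sum.elim 0 u₀ : ι₁ ⊕ ι₀ → F) (Sum.inl i)) *
    (g : (ι₀ → F) → ℂ) (fun j => (Sum.elim 0 u₀ : ι₁ ⊕ ι₀ → F) (Sum.inr j)) = _
  have h1 : (fun i => (Sum.elim 0 u₀ : ι₁ ⊕ ι₀ → F) (Sum.inl i)) = (0 : ι₁ → F) := rfl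
  have h2 : (fun j => (Sum.elim 0 u₀ : ι₁ ⊕ ι₀ → F) (Sum.inr j)) = u₀ := rfl
  rw [h1, h2, coe_piBallSB, Set.indicator_of_mem (zero_mem_piPrimePowBall (F := F) (ι := ι₁) 0), one_mul]

/-! ## §2 The kernel of the fibre over `0` is the span of the `Y`-coboundaries -/

/-- **`Y` dies on the fibre over `0`**: `φ₀ (ρ(0, (y₁, 0), 0) f) = φ₀ f` — on `X₀ = {u|ι₁ = 0}` the modulation `ψ(⟨u|ι₁, y₁⟩)` is `1`.
[cite: MoeglinVignerasWaldspurger1987, Chap. 2 I.4 Exemple (1)] -/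
theorem fibreZero_schrodingerSB_piModul (y₁ : ι₁ → F) (f : SchwartzBruhat (ι₁ ⊕ ι₀ → F)) :
    φ₀ (schrodingerSB (dotProductBilin F F) ψ hl hb (piModul (Sum.elim y₁ 0)) f) = φ₀ f := by
  apply Subtype.ext
  funext u₀
  rw [hφ₀, hφ₀, schrodingerSB_piModul_apply, sumElim_dotProduct_sumElim, zero_dotProduct, dotProduct_zero, add_zero,
    AddChar.map_zero_eq_one, Circle.coe_one, one_mul]

/-- Hence every `Y`-coboundary `ρ(y) φ − φ` lies in `ker φ₀`. [cite: BernsteinZelevinsky1976, §2.30] -/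
theorem span_cobdry_le_ker_fibreZero :
    Submodule.span ℂ (Set.range fun p : (ι₁ → F) × SchwartzBruhat (ι₁ ⊕ ι₀ → F) =>
        schrodingerSB (dotProductBilin F F) ψ hl hb (piModul (Sum.elim p.1 0)) p.2 - p.2) ≤ LinearMap.ker φ₀ := by
  rw [Submodule.span_le]
  rintro _ ⟨⟨y₁, f⟩, rfl⟩
  rw [SetLike.mem_coe, LinearMap.mem_ker, map_sub, fibreZero_schrodingerSB_piModul hl hb φ₀ hφ₀, sub_self]

omit [ValuativeRel F] [IsNonarchimedeanLocalField F] hφ₀ in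
/-- **separation**: a point off `X₀ = {u|ι₁ = 0}` is moved by some modulation of `Y` — `u|ι₁ ≠ 0 ⇒ ψ(⟨u|ι₁, y₁⟩) ≠ 1` for some `y₁` (`ψ` non-trivial:
choose the coordinate `i` with `u i ≠ 0` and `y₁ = (z ∕ u i) e_i` with `ψ z ≠ 1`). [cite: MoeglinVignerasWaldspurger1987, Chap. 2 I.3] -/
theorem exists_addChar_dotProduct_ne_one [DecidableEq ι₁] (hψ : ψ.IsContinuousNontrivial) {u : ι₁ ⊕ ι₀ → F} (hu : u ∘ Sum.inl ≠ 0) :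
    ∃ y₁ : ι₁ → F, ψ (u ⬝ᵥ Sum.elim y₁ 0) ≠ 1 := by
  obtain ⟨i, hi⟩ : ∃ i, u (Sum.inl i) ≠ 0 := by
    by_contra h
    push Not at h
    exact hu (funext h)
  obtain ⟨z, hz⟩ : ∃ z : F, ψ z ≠ 1 := AddChar.ne_zero_iff.1 hψ.2
  refine ⟨Pi.single i (z / u (Sum.inl i)), ?_⟩
  rw [dotProduct_sumElim_zero, dotProduct_single, Function.comp_apply, mul_div_cancel₀ z hi]
  exact hz

/-- **THE COBOUNDARY DIRECTION** (Kudla's partition trick, ★ p829212): if `φ₀ f = 0` then `f` is a finite sum of `Y`-coboundaries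
`ρ(0,(y₁,0),0) φ − φ`.  [cite: Kudla1986, proof of Thm. 2.8] [cite: MoeglinVignerasWaldspurger1987, Chap. 3 §IV.5] [cite: BernsteinZelevinsky1976, §1.1] -/
theorem mem_span_of_fibreZero_eq_zero (hψ : ψ.IsContinuousNontrivial) {f : SchwartzBruhat (ι₁ ⊕ ι₀ → F)} (hf : φ₀ f = 0) :
    f ∈ Submodule.span ℂ (Set.range fun p : (ι₁ → F) × SchwartzBruhat (ι₁ ⊕ ι₀ → F) =>
        schrodingerSB (dotProductBilin F F) ψ hl hb (piModul (Sum.elim p.1 0)) p.2 - p.2) := by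
  classical
  -- the multipliers `u ↦ ψ(⟨u, (y₁, 0)⟩)`, locally constant, moving every point off `X₀ = {u|ι₁ = 0}`
  set 𝒰 : Set ((ι₁ ⊕ ι₀ → F) → ℂ) := Set.range fun y₁ : ι₁ → F => fun u => ((ψ (u ⬝ᵥ Sum.elim y₁ 0) : Circle) : ℂ) with h𝒰
  have h𝒰lc : ∀ u ∈ 𝒰, IsLocallyConstant u := by
    rintro _ ⟨y₁, rfl⟩
    exact (hl.comp_continuous (hb (Sum.elim y₁ 0))).comp Subtype.val
  have hsep : ∀ u : ι₁ ⊕ ι₀ → F, u ∉ {u | u ∘ Sum.inl = 0} → ∃ m ∈ 𝒰, m u ≠ 1 := by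
    intro u hu
    obtain ⟨y₁, hy₁⟩ := exists_addChar_dotProduct_ne_one hψ hu
    exact ⟨_, ⟨y₁, rfl⟩, fun h => hy₁ (Circle.coe_inj.1 (by rw [Circle.coe_one]; exact h))⟩
  have hf₀ : ∀ u ∈ {u : ι₁ ⊕ ι₀ → F | u ∘ Sum.inl = 0}, (f : (ι₁ ⊕ ι₀ → F) → ℂ) u = 0 := by
    intro u hu
    rw [eq_sumElim_zero_of_comp_inl_eq_zero hu, ← hφ₀, hf]
    rfl
  have hmem := mem_span_mul_sub_of_forall_eq_zero 𝒰 h𝒰lc {u | u ∘ Sum.inl = 0} hsep f.2 hf₀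
  -- the ambient span is the image of ours under the inclusion `𝒮 ↪ (X → ℂ)`
  have hle : Submodule.span ℂ {g : (ι₁ ⊕ ι₀ → F) → ℂ | ∃ u' ∈ 𝒰, ∃ φ ∈ SchwartzBruhat (ι₁ ⊕ ι₀ → F), g = u' * φ - φ} ≤
      (Submodule.span ℂ (Set.range fun p : (ι₁ → F) × SchwartzBruhat (ι₁ ⊕ ι₀ → F) =>
        schrodingerSB (dotProductBilin F F) ψ hl hb (piModul (Sum.elim p.1 0)) p.2 - p.2)).map
        (SchwartzBruhat (ι₁ ⊕ ι₀ → F)).subtype := by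
    refine Submodule.span_le.2 ?_
    rintro _ ⟨_, ⟨y₁, rfl⟩, φ, hφ, rfl⟩
    refine ⟨schrodingerSB (dotProductBilin F F) ψ hl hb (piModul (Sum.elim y₁ 0)) ⟨φ, hφ⟩ - ⟨φ, hφ⟩,
      Submodule.subset_span ⟨(y₁, ⟨φ, hφ⟩), rfl⟩, ?_⟩
    rw [map_sub, Submodule.subtype_apply, Submodule.subtype_apply]
    congr 1
    funext u
    rw [schrodingerSB_piModul_apply]
    rfl
  obtain ⟨g, hg, hgf⟩ := hle hmem
  have : g = f := Subtype.ext hgf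
  rw [← this]
  exact hg

/-- **`ker φ₀ = span {ρ(y) φ − φ : y ∈ Y}`** — the fibre over `0` computes the `Y`-coinvariants.
[cite: Kudla1986, proof of Thm. 2.8] [cite: MoeglinVignerasWaldspurger1987, Chap. 3 §IV.2] -/
theorem ker_fibreZero_eq_span (hψ : ψ.IsContinuousNontrivial) :
    LinearMap.ker φ₀ = Submodule.span ℂ (Set.range fun p : (ι₁ → F) × SchwartzBruhat (ι₁ ⊕ ι₀ → F) =>
        schrodingerSB (dotProductBilin F F) ψ hl hb (piModul (Sum.elim p.1 0)) p.2 - p.2) :=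
  le_antisymm (fun _ hf => mem_span_of_fibreZero_eq_zero hl hb φ₀ hφ₀ hψ (LinearMap.mem_ker.1 hf))
    (span_cobdry_le_ker_fibreZero hl hb φ₀ hφ₀)

/-! ## §3 Equivariance: `φ₀` intertwines `ρ|_{H(Y^⊥)}` with the Schrödinger model of `H(𝕎₁)`, `𝕎₁ = Y^⊥ ∕ Y = F^{ι₀} × F^{ι₀}` -/

/-- **EQUIVARIANCE FOR `H(Y^⊥)`**: for `h = ((x, y), t)` with `x|ι₁ = 0`, `φ₀ (ρ h f) = ρ₀((x|ι₀, y|ι₀), t) (φ₀ f)` — the fibre over `0` carries the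
restriction of `ρ` to `H(Y^⊥) = {x|ι₁ = 0}` to the dot Schrödinger model `ρ₀` of `H(𝕎₁)` along `H(Y^⊥) ↠ H(Y^⊥ ∕ Y)`.
[cite: MoeglinVignerasWaldspurger1987, Chap. 3 §IV.2] [cite: Kudla1986, proof of Thm. 2.8] -/
theorem fibreZero_schrodingerSB_of_comp_inl_eq_zero (h : Heisenberg (polar (dotProductBilin F F (m := ι₁ ⊕ ι₀))))
    (hh : h.v.1 ∘ Sum.inl = 0) (f : SchwartzBruhat (ι₁ ⊕ ι₀ → F)) :
    φ₀ (schrodingerSB (dotProductBilin F F) ψ hl hb h f) =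
      schrodingerSB (dotProductBilin F F) ψ hl hb₀ ⟨(h.v.1 ∘ Sum.inr, h.v.2 ∘ Sum.inr), h.t⟩ (φ₀ f) := by
  apply Subtype.ext
  funext u₀
  rw [hφ₀, schrodingerSB_apply, schrodingerSB_apply, hφ₀, dotProductBilin_apply_apply, dotProductBilin_apply_apply,
    sumElim_zero_dotProduct]
  congr 2
  conv_lhs => rw [eq_sumElim_zero_of_comp_inl_eq_zero hh, sumElim_add_sumElim, add_zero]

/-- The same for the explicit elements `((0 ⊔ x₀, y₁ ⊔ y₀), t)` of `H(Y^⊥)`: `φ₀ (ρ((0 ⊔ x₀, y₁ ⊔ y₀), t) f) = ρ₀((x₀, y₀), t) (φ₀ f)`.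
[cite: MoeglinVignerasWaldspurger1987, Chap. 3 §IV.2] -/
theorem fibreZero_schrodingerSB_sumElim (x₀ : ι₀ → F) (y₁ : ι₁ → F) (y₀ : ι₀ → F) (t : F) (f : SchwartzBruhat (ι₁ ⊕ ι₀ → F)) :
    φ₀ (schrodingerSB (dotProductBilin F F) ψ hl hb ⟨(Sum.elim 0 x₀, Sum.elim y₁ y₀), t⟩ f) =
      schrodingerSB (dotProductBilin F F) ψ hl hb₀ ⟨(x₀, y₀), t⟩ (φ₀ f) :=
  fibreZero_schrodingerSB_of_comp_inl_eq_zero hl hb hb₀ φ₀ hφ₀ ⟨(Sum.elim 0 x₀, Sum.elim y₁ y₀), t⟩ rfl f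

/-- In particular `Y` acts trivially and the centre by `ψ` on the fibre: `φ₀ (ρ((0, (y₁, 0)), t) f) = ψ t • φ₀ f`.
[cite: MoeglinVignerasWaldspurger1987, Chap. 2 I.2] -/
theorem fibreZero_schrodingerSB_modul_center (y₁ : ι₁ → F) (t : F) (f : SchwartzBruhat (ι₁ ⊕ ι₀ → F)) :
    φ₀ (schrodingerSB (dotProductBilin F F) ψ hl hb ⟨(0, Sum.elim y₁ 0), t⟩ f) = ((ψ t : Circle) : ℂ) • φ₀ f := by
  apply Subtype.ext
  funext u₀
  rw [hφ₀, schrodingerSB_apply, dotProductBilin_apply_apply, sumElim_dotProduct_sumElim, zero_dotProduct, dotProduct_zero,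
    add_zero, add_zero, add_zero]
  rw [Submodule.coe_smul, Pi.smul_apply, smul_eq_mul, hφ₀]

/-! ## §4 The `Y`-coinvariants: `𝒮 ∕ span ≅ 𝒮(F^{ι₀})`, irreducible under `H(𝕎₁)`; `TwistedCoinv` currency -/

/-- **`S_Y ≅ 𝒮(F^{ι₀})`**: the quotient of `𝒮(F^{ι₁ ⊔ ι₀})` by the `Y`-coboundaries is identified with `𝒮(F^{ι₀})` THROUGH `φ₀`.
[cite: MoeglinVignerasWaldspurger1987, Chap. 3 §IV.2] [cite: BernsteinZelevinsky1976, §2.30–2.33] -/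
theorem exists_quotient_span_equiv_fibre (hψ : ψ.IsContinuousNontrivial) :
    ∃ e : (SchwartzBruhat (ι₁ ⊕ ι₀ → F) ⧸ Submodule.span ℂ (Set.range fun p : (ι₁ → F) × SchwartzBruhat (ι₁ ⊕ ι₀ → F) =>
        schrodingerSB (dotProductBilin F F) ψ hl hb (piModul (Sum.elim p.1 0)) p.2 - p.2)) ≃ₗ[ℂ] SchwartzBruhat (ι₀ → F),
      ∀ f, e (Submodule.Quotient.mk f) = φ₀ f :=
  ⟨(Submodule.quotEquivOfEq _ _ (ker_fibreZero_eq_span hl hb φ₀ hφ₀ hψ).symm).trans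
      (φ₀.quotKerEquivOfSurjective (fibreZero_surjective φ₀ hφ₀)), fun _ => rfl⟩

include hb₀ in
/-- **`S_Y` IS IRREDUCIBLE UNDER `H(Y^⊥)`** (equivalently under `H(𝕎₁)`; `Y` and the centre act by scalars): a subspace of `𝒮(F^{ι₁ ⊔ ι₀})` that
contains the `Y`-coboundaries and is stable under every `ρ(h)`, `h ∈ H(Y^⊥)`, is the span of the coboundaries or everything.  (Its image under
`φ₀` is a `ρ₀(H(𝕎₁))`-stable subspace of `𝒮(F^{ι₀})`, hence `⊥` or `⊤` by ★ `eq_bot_or_eq_top_of_invariant_schrodingerSB_pi`; pull back along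
`ker φ₀ = span`.)  This is the Stone–von Neumann characterisation of `S_Y` [MVW Chap. 2 I.2] in the adapted model.
[cite: MoeglinVignerasWaldspurger1987, Chap. 2 I.2–I.3] [cite: Kudla1986, proof of Thm. 2.8] -/
theorem eq_span_or_eq_top_of_invariant (hψ : ψ.IsContinuousNontrivial) (W : Submodule ℂ (SchwartzBruhat (ι₁ ⊕ ι₀ → F)))
    (hle : Submodule.span ℂ (Set.range fun p : (ι₁ → F) × SchwartzBruhat (ι₁ ⊕ ι₀ → F) =>
        schrodingerSB (dotProductBilin F F) ψ hl hb (piModul (Sum.elim p.1 0)) p.2 - p.2) ≤ W)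
    (hW : ∀ h : Heisenberg (polar (dotProductBilin F F (m := ι₁ ⊕ ι₀))), h.v.1 ∘ Sum.inl = 0 →
      ∀ f ∈ W, schrodingerSB (dotProductBilin F F) ψ hl hb h f ∈ W) :
    W = Submodule.span ℂ (Set.range fun p : (ι₁ → F) × SchwartzBruhat (ι₁ ⊕ ι₀ → F) =>
        schrodingerSB (dotProductBilin F F) ψ hl hb (piModul (Sum.elim p.1 0)) p.2 - p.2) ∨ W = ⊤ := by
  have hker := ker_fibreZero_eq_span hl hb φ₀ hφ₀ hψ
  -- the image `φ₀(W)` is `ρ₀(H(𝕎₁))`-stable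
  have hst : ∀ (h₀ : Heisenberg (polar (dotProductBilin F F (m := ι₀)))) (g : SchwartzBruhat (ι₀ → F)), g ∈ W.map φ₀ →
      schrodingerSB (dotProductBilin F F) ψ hl hb₀ h₀ g ∈ W.map φ₀ := by
    rintro ⟨⟨x₀, y₀⟩, t⟩ _ ⟨f, hf, rfl⟩
    refine ⟨schrodingerSB (dotProductBilin F F) ψ hl hb ⟨(Sum.elim 0 x₀, Sum.elim 0 y₀), t⟩ f, hW _ rfl f hf, ?_⟩
    rw [fibreZero_schrodingerSB_sumElim hl hb hb₀ φ₀ hφ₀]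
  rcases eq_bot_or_eq_top_of_invariant_schrodingerSB_pi hl hb₀ hψ (W.map φ₀) hst with h0 | h1
  · left
    refine le_antisymm (fun f hf => ?_) hle
    rw [← hker, LinearMap.mem_ker, ← Submodule.mem_bot ℂ, ← h0]
    exact ⟨f, hf, rfl⟩
  · right
    rw [eq_top_iff]
    intro f _
    obtain ⟨w, hw, hwf⟩ : φ₀ f ∈ W.map φ₀ := by rw [h1]; exact Submodule.mem_top
    have hfw : f - w ∈ W := by
      apply hle
      rw [← hker, LinearMap.mem_ker, map_sub, hwf, sub_self]
    simpa using W.add_mem hfw hw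

section TwistedCoinv

variable {Z : Type*} [Group Z] (j : Z →* Heisenberg (polar (dotProductBilin F F (m := ι₁ ⊕ ι₀)))) (χ : Z →* ℂˣ) (π : Z → ι₁ → F)
  (hj : ∀ z, (j z).v = (0, Sum.elim (π z) 0)) (hχ : ∀ z, ((χ z : ℂˣ) : ℂ) = ((ψ (j z).t : Circle) : ℂ))

include hj hχ

omit hφ₀ hχ in
/-- an element `((0, (y₁, 0)), t)` of `Ỹ = Y · centre` acts by `ψ t` times the modulation `ρ(0, (y₁, 0), 0)`.
[cite: MoeglinVignerasWaldspurger1987, Chap. 2 I.2] -/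
theorem schrodingerSB_comp_of_v_eq (z : Z) (f : SchwartzBruhat (ι₁ ⊕ ι₀ → F)) :
    (schrodingerSB (dotProductBilin F F) ψ hl hb).comp j z f =
      ((ψ (j z).t : Circle) : ℂ) • schrodingerSB (dotProductBilin F F) ψ hl hb (piModul (Sum.elim (π z) 0)) f := by
  apply Subtype.ext
  funext u
  rw [MonoidHom.comp_apply, schrodingerSB_apply, Submodule.coe_smul, Pi.smul_apply, smul_eq_mul, schrodingerSB_piModul_apply,
    dotProductBilin_apply_apply, hj, coe_addChar_add, mul_assoc, add_zero]

/-- **`TwistedCoinv` CURRENCY, kernel**: for any homomorphism `j : Z → H(𝕎)` with values `((0, (π z, 0)), t_z)` (onto `Ỹ = Y · centre` when `π` is onto)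
read with the character `χ z = ψ(t_z)`, the relation submodule of the `χ`-coinvariants of `ρ ∘ j` is contained in `ker φ₀`, with EQUALITY when `π` is
surjective (`ψ` non-trivial). [cite: BernsteinZelevinsky1976, §2.30–2.33] [cite: MoeglinVignerasWaldspurger1987, Chap. 3 §IV.2] -/
theorem twistedCoinv_ker_le_ker_fibreZero :
    TwistedCoinv.ker ((schrodingerSB (dotProductBilin F F) ψ hl hb).comp j) χ ≤ LinearMap.ker φ₀ := by
  refine TwistedCoinv.ker_le_ker _ χ φ₀ fun z f => ?_
  rw [schrodingerSB_comp_of_v_eq hl hb j π hj, map_smul, fibreZero_schrodingerSB_piModul hl hb φ₀ hφ₀, hχ]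

/-- **`TwistedCoinv.ker (ρ ∘ j) χ = ker φ₀`** when `π` is onto `F^{ι₁}`. [cite: BernsteinZelevinsky1976, §2.30–2.33] [cite: Kudla1986, proof of Thm. 2.8] -/
theorem twistedCoinv_ker_eq_ker_fibreZero (hψ : ψ.IsContinuousNontrivial) (hπ : Function.Surjective π) :
    TwistedCoinv.ker ((schrodingerSB (dotProductBilin F F) ψ hl hb).comp j) χ = LinearMap.ker φ₀ := by
  refine le_antisymm (twistedCoinv_ker_le_ker_fibreZero hl hb φ₀ hφ₀ j χ π hj hχ) ?_
  rw [ker_fibreZero_eq_span hl hb φ₀ hφ₀ hψ, Submodule.span_le]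
  rintro _ ⟨⟨y₁, f⟩, rfl⟩
  obtain ⟨z, rfl⟩ := hπ y₁
  have hgen := TwistedCoinv.sub_mem_ker ((schrodingerSB (dotProductBilin F F) ψ hl hb).comp j) χ z f
  have h1 : (schrodingerSB (dotProductBilin F F) ψ hl hb).comp j z f =
      ((χ z : ℂˣ) : ℂ) • schrodingerSB (dotProductBilin F F) ψ hl hb (piModul (Sum.elim (π z) 0)) f := by
    rw [hχ]
    exact schrodingerSB_comp_of_v_eq hl hb j π hj z f
  rw [h1] at hgen
  have := Submodule.smul_mem _ (((χ z : ℂˣ) : ℂ))⁻¹ hgen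
  rwa [smul_sub, inv_smul_smul₀ (Units.ne_zero _), inv_smul_smul₀ (Units.ne_zero _)] at this

/-- **`TwistedCoinv` CURRENCY, the model**: `TwistedCoinv.Coinv (ρ ∘ j) χ ≃ₗ[ℂ] 𝒮(F^{ι₀})` THROUGH `φ₀` (`e (mk f) = φ₀ f`), for `π` onto and `ψ`
non-trivial — the `Y`-coinvariants of the Schrödinger model ARE the Schrödinger model of `H(𝕎₁)` on `𝒮(F^{ι₀})` (transport of structure along `e`
and §3). [cite: MoeglinVignerasWaldspurger1987, Chap. 3 §IV.2] [cite: Kudla1986, proof of Thm. 2.8] -/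
theorem exists_twistedCoinv_equiv_fibre (hψ : ψ.IsContinuousNontrivial) (hπ : Function.Surjective π) :
    ∃ e : TwistedCoinv.Coinv ((schrodingerSB (dotProductBilin F F) ψ hl hb).comp j) χ ≃ₗ[ℂ] SchwartzBruhat (ι₀ → F),
      ∀ f, e (TwistedCoinv.mk _ χ f) = φ₀ f := by
  have hker := twistedCoinv_ker_eq_ker_fibreZero hl hb φ₀ hφ₀ j χ π hj hχ hψ hπ
  exact ⟨(Submodule.quotEquivOfEq _ _ hker).trans (φ₀.quotKerEquivOfSurjective (fibreZero_surjective φ₀ hφ₀)), fun _ => rfl⟩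

/-- **equivariance of the model isomorphism**: if a group `G` acts on `𝒮(F^{ι₁ ⊔ ι₀})` by `ρV` commuting with `ρ(j(Z))` and `φ₀` carries `ρV` to a
representation `σ` on `𝒮(F^{ι₀})` (e.g. `G ≤ H(Y^⊥)` through `ρ` and `σ = ρ₀ ∘ (H(Y^⊥) ↠ H(𝕎₁))`, §3), then the factored map
`TwistedCoinv.lift φ₀ : Coinv (ρ ∘ j) χ → 𝒮(F^{ι₀})` intertwines `TwistedCoinv.rep` with `σ`, is onto, and is injective (`π` onto, `ψ` non-trivial).
[cite: MoeglinVignerasWaldspurger1987, Chap. 3 §IV.2] [cite: BernsteinZelevinsky1976, §2.30–2.33] -/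
theorem lift_fibreZero_bijective_equivariant (hψ : ψ.IsContinuousNontrivial) (hπ : Function.Surjective π)
    {G : Type*} [Group G] (ρV : Representation ℂ G (SchwartzBruhat (ι₁ ⊕ ι₀ → F)))
    (hc : ∀ (g : G) (z : Z), Commute (ρV g) ((schrodingerSB (dotProductBilin F F) ψ hl hb).comp j z))
    (σ : Representation ℂ G (SchwartzBruhat (ι₀ → F))) (hσ : ∀ (g : G) (f : SchwartzBruhat (ι₁ ⊕ ι₀ → F)), φ₀ (ρV g f) = σ g (φ₀ f)) :
    Function.Bijective (TwistedCoinv.lift ((schrodingerSB (dotProductBilin F F) ψ hl hb).comp j) χ φ₀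
        (fun z f => by rw [schrodingerSB_comp_of_v_eq hl hb j π hj, map_smul, fibreZero_schrodingerSB_piModul hl hb φ₀ hφ₀, hχ])) ∧
      ∀ (g : G) (x : TwistedCoinv.Coinv ((schrodingerSB (dotProductBilin F F) ψ hl hb).comp j) χ),
        TwistedCoinv.lift _ χ φ₀
            (fun z f => by rw [schrodingerSB_comp_of_v_eq hl hb j π hj, map_smul, fibreZero_schrodingerSB_piModul hl hb φ₀ hφ₀, hχ])
            (TwistedCoinv.rep χ ρV hc g x) =
          σ g (TwistedCoinv.lift _ χ φ₀
            (fun z f => by rw [schrodingerSB_comp_of_v_eq hl hb j π hj, map_smul, fibreZero_schrodingerSB_piModul hl hb φ₀ hφ₀, hχ]) x) := by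
  refine ⟨⟨?_, ?_⟩, fun g x => TwistedCoinv.lift_rep χ ρV hc φ₀ _ σ hσ g x⟩
  · -- injective: `ker (lift φ₀) = 0` because `ker φ₀ = TwistedCoinv.ker`
    intro x y hxy
    obtain ⟨f, rfl⟩ := TwistedCoinv.mk_surjective _ χ x
    obtain ⟨g, rfl⟩ := TwistedCoinv.mk_surjective _ χ y
    rw [TwistedCoinv.lift_mk, TwistedCoinv.lift_mk] at hxy
    rw [TwistedCoinv.mk_apply, TwistedCoinv.mk_apply, Submodule.Quotient.eq,
      twistedCoinv_ker_eq_ker_fibreZero hl hb φ₀ hφ₀ j χ π hj hχ hψ hπ, LinearMap.mem_ker, map_sub, hxy, sub_self]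
  · intro g
    obtain ⟨f, rfl⟩ := fibreZero_surjective φ₀ hφ₀ g
    exact ⟨TwistedCoinv.mk _ χ f, TwistedCoinv.lift_mk _ χ φ₀ _ f⟩

end TwistedCoinv

end Summit.HodgeConjecture.HodgeConjecture.Cruxes.H413.F0P2oHeisenbergYCoinvariants

end
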